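import Literature.Geometry.Symplectic.SteinJConvexOpen
import Literature.Topology.FourManifolds.SPC4MorseExistence
import HarnessLib

/-!
# Strict `J`-convexity survives Milnor's bump perturbations: the threshold

Topic `Literature/Geometry/Symplectic`; part of the discharge of the named fact
`Literature.Geometry.Symplectic.Gompf1998_thm13_indexLE_two` (`SteinHandlebodies.lean`;
Gompf 1998, Thm. 1.3 (Eliashberg 1990), compact case, "only if", condition (a)), step "the
`J`-convex defining function of a Stein domain may be assumed Morse" (Eliashberg 1990, §1;
Cieliebak–Eliashberg 2012, §2.1: `J`-convexity is a `C²`-open condition), prepared for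
Milnor's proof of the density theorem (Milnor 1965, Thm. 2.5: perturb by finitely many
bump × small-linear-form terms `ChartBall.pert ℓ = ρ · (ℓ ∘ chart)` in interior chart balls,
`SPC4MorseExistence.lean`).  The companion file `SteinMorsePerturbation.lean` runs the
iteration with the threshold proved here as a fifth invariant.

In the tree's formalism (`SteinDomain.lean`: Levi form `-dd^ℂφ_x(v, J_x v)` for a field `J`
preserving smooth vector fields) this file proves:

* `levi_sum` — the Levi form of a finite linear combination `∑ a_j ψ_j`;
* `clm_apply_eq_sum_single`, `abs_apply_single_le`, `pert_eq_sum` — a bump perturbation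
  `κ.pert ℓ` is the combination `∑_j ℓ(e_j) ψ_j` of the **four fixed** smooth functions
  `ψ_j = κ.pert (proj j)`, with coefficients `|ℓ(e_j)| ≤ ‖ℓ‖`;
* `exists_forall_levi_pos` — **the `J`-convexity threshold**: if `f` is strictly `J`-convex
  on all of the compact `W`, so is `f + κ.pert ℓ` for all `‖ℓ‖ ≤ δ` (uniform openness of
  `J`-convexity on compact sets, `exists_levi_pos_perturb_of_isCompact` of
  `SteinJConvexOpen.lean`, applied to each `ψ_j`, and convexity of the cone of `J`-convex
  functions: `f + ∑ a_j ψ_j = ¼ ∑_j (f + 4 a_j ψ_j)`).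

Everything is **proved**; no definition, no named fact.

## References

* K. Cieliebak, Ya. Eliashberg, *From Stein to Weinstein and back*, AMS Coll. Publ. 59 (2012),
  §2.1, §3.1–§3.2. [CieliebakEliashberg2012]
* Ya. Eliashberg, *Topological characterization of Stein manifolds of dimension > 2*, Internat.
  J. Math. 1 (1990), 29–46, §1–§2. [Eliashberg1990Stein]
* J. Milnor, *Lectures on the h-cobordism theorem*, Princeton (1965), §2, Thm. 2.5.
  [MilnorHCobordism1965]
-/

noncomputable section

open scoped Manifold ContDiff Topology
open Set Function Filter

namespace Literature.Geometry.Symplectic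

open Literature.Geometry.Kaehler Literature.Topology.FourManifolds

variable {W : Type*} [TopologicalSpace W] [T2Space W] [ChartedSpace (EuclideanHalfSpace 4) W]
  [IsManifold (𝓡∂ 4) ∞ W] {J : (x : W) → (EuclideanSpace ℝ (Fin 4) →L[ℝ] EuclideanSpace ℝ (Fin 4))}

/-! ### The Levi form of a finite linear combination -/

section LeviSum

/-- **The Levi form of a finite linear combination**: `Levi(∑ a_j ψ_j) = ∑ a_j Levi(ψ_j)` for
smooth `ψ_j` (`levi_add`, `levi_const_mul` of `SteinSmoothMax.lean`).
[cite: CieliebakEliashberg2012, §3.1] -/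
theorem levi_sum (hJ : PreservesSmoothFields J) {ι : Type*} (s : Finset ι) {ψ : ι → W → ℝ}
    (hψ : ∀ j, ContMDiff (𝓡∂ 4) 𝓘(ℝ, ℝ) ∞ (ψ j)) (a : ι → ℝ) (x : W)
    (V : Fin 2 → EuclideanSpace ℝ (Fin 4)) :
    -(mextDeriv (dComplex J (fun y => ∑ j ∈ s, a j * ψ j y)) x V) =
      ∑ j ∈ s, a j * -(mextDeriv (dComplex J (ψ j)) x V) := by
  classical
  induction s using Finset.induction_on with
  | empty =>
    simp only [Finset.sum_empty]
    have h := levi_const_mul (J := J) (contMDiff_const (c := (0 : ℝ))) 0 x V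
    simp only [zero_mul] at h
    exact h
  | insert j s hj ih =>
    have hs : ContMDiff (𝓡∂ 4) 𝓘(ℝ, ℝ) ∞ (fun y => ∑ i ∈ s, a i * ψ i y) :=
      ContMDiff.sum fun i _ => contMDiff_const.mul (hψ i)
    have hjs : ContMDiff (𝓡∂ 4) 𝓘(ℝ, ℝ) ∞ (fun y => a j * ψ j y) := contMDiff_const.mul (hψ j)
    simp only [Finset.sum_insert hj]
    have heq : (fun y => a j * ψ j y + ∑ i ∈ s, a i * ψ i y) =
        (fun y => a j * ψ j y) + fun y => ∑ i ∈ s, a i * ψ i y := rfl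
    rw [heq, levi_add hJ hjs hs, levi_const_mul (hψ j), ih]

end LeviSum

/-! ### Bump perturbations are combinations of four fixed smooth functions -/

section Pert

omit [T2Space W] [IsManifold (𝓡∂ 4) ∞ W] in
/-- A linear form on `ℝ⁴` along the standard basis: `ℓ w = ∑ w_j ℓ(e_j)`. [folklore] -/
theorem clm_apply_eq_sum_single (ℓ : EuclideanSpace ℝ (Fin 4) →L[ℝ] ℝ)
    (w : EuclideanSpace ℝ (Fin 4)) : ℓ w = ∑ j, w j * ℓ (EuclideanSpace.single j 1) := by
  conv_lhs => rw [← (EuclideanSpace.basisFun (Fin 4) ℝ).sum_repr w]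
  simp [map_sum, map_smul, smul_eq_mul]

omit [T2Space W] [IsManifold (𝓡∂ 4) ∞ W] in
/-- The coefficients are bounded by the operator norm: `|ℓ(e_j)| ≤ ‖ℓ‖`. [folklore] -/
theorem abs_apply_single_le (ℓ : EuclideanSpace ℝ (Fin 4) →L[ℝ] ℝ) (j : Fin 4) :
    |ℓ (EuclideanSpace.single j 1)| ≤ ‖ℓ‖ := by
  have h := ℓ.le_opNorm (EuclideanSpace.single j 1)
  rw [PiLp.norm_single, norm_one, mul_one, Real.norm_eq_abs] at h
  exact h

omit [T2Space W] [IsManifold (𝓡∂ 4) ∞ W] in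
/-- **A bump perturbation is a combination of four fixed smooth functions**:
`κ.pert ℓ = ∑_j ℓ(e_j) · κ.pert (proj j)`. [folklore] -/
theorem pert_eq_sum (κ : ChartBall (𝓡∂ 4) W) (ℓ : EuclideanSpace ℝ (Fin 4) →L[ℝ] ℝ) :
    κ.pert ℓ = fun y => ∑ j, ℓ (EuclideanSpace.single j 1) *
      κ.pert (EuclideanSpace.proj j : EuclideanSpace ℝ (Fin 4) →L[ℝ] ℝ) y := by
  funext y
  simp only [ChartBall.pert]
  rw [clm_apply_eq_sum_single ℓ, Finset.mul_sum]
  refine Finset.sum_congr rfl fun j _ => ?_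
  simp only [PiLp.proj_apply]
  ring

end Pert

/-! ### The `J`-convexity threshold -/

section Threshold

variable [CompactSpace W]

/-- **Threshold for strict `J`-convexity**: if the smooth `f` is strictly `J`-convex at every
point of the compact `W` (`J` preserving smooth vector fields), then so is every bump
perturbation `f + κ.pert ℓ` with `‖ℓ‖ ≤ δ`, for some `δ > 0`.  Proof: `κ.pert ℓ = ∑ a_j ψ_j`
with `ψ_j = κ.pert (proj j)` fixed and `|a_j| ≤ ‖ℓ‖` (`pert_eq_sum`); by the uniform openness
of `J`-convexity on compact sets (`exists_levi_pos_perturb_of_isCompact`) each `f + t ψ_j` is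
strictly `J`-convex on `W` for `|t| < ε_j`; and
`Levi(f + ∑ a_j ψ_j) = ¼ ∑_j Levi(f + 4 a_j ψ_j) > 0` for `4 |a_j| < ε_j`.
[cite: CieliebakEliashberg2012, §3.2] -/
theorem exists_forall_levi_pos (κ : ChartBall (𝓡∂ 4) W) (hJ : PreservesSmoothFields J)
    {f : W → ℝ} (hf : ContMDiff (𝓡∂ 4) 𝓘(ℝ, ℝ) ∞ f)
    (hconv : ∀ x (v : EuclideanSpace ℝ (Fin 4)), v ≠ 0 →
      0 < -(mextDeriv (dComplex J f) x ![v, J x v])) :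
    ∃ δ > 0, ∀ ℓ : EuclideanSpace ℝ (Fin 4) →L[ℝ] ℝ, ‖ℓ‖ ≤ δ →
      ∀ x (v : EuclideanSpace ℝ (Fin 4)), v ≠ 0 →
        0 < -(mextDeriv (dComplex J (f + κ.pert ℓ)) x ![v, J x v]) := by
  set ψ : Fin 4 → W → ℝ := fun j =>
    κ.pert (EuclideanSpace.proj j : EuclideanSpace ℝ (Fin 4) →L[ℝ] ℝ) with hψdef
  have hψ : ∀ j, ContMDiff (𝓡∂ 4) 𝓘(ℝ, ℝ) ∞ (ψ j) := fun j => κ.contMDiff_pert _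
  have hthr : ∀ j, ∃ ε : ℝ, 0 < ε ∧ ∀ t : ℝ, |t| < ε →
      ∀ x (v : EuclideanSpace ℝ (Fin 4)), v ≠ 0 →
        0 < -(mextDeriv (dComplex J (f + fun y => t * ψ j y)) x ![v, J x v]) := by
    intro j
    obtain ⟨U, -, hKU, ε, hε, h⟩ := exists_levi_pos_perturb_of_isCompact hJ hf (hψ j)
      isCompact_univ (fun x _ v hv => hconv x v hv)
    exact ⟨ε, hε, fun t ht x v hv => h t ht x (hKU (mem_univ x)) v hv⟩
  choose ε hε hpos using hthr
  set ε₀ : ℝ := min (min (ε 0) (ε 1)) (min (ε 2) (ε 3)) with hε₀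
  have hε₀pos : 0 < ε₀ := lt_min (lt_min (hε 0) (hε 1)) (lt_min (hε 2) (hε 3))
  have hε₀le : ∀ j, ε₀ ≤ ε j := fun j => by
    fin_cases j
    · exact (min_le_left _ _).trans (min_le_left _ _)
    · exact (min_le_left _ _).trans (min_le_right _ _)
    · exact (min_le_right _ _).trans (min_le_left _ _)
    · exact (min_le_right _ _).trans (min_le_right _ _)
  refine ⟨ε₀ / 8, by positivity, fun ℓ hℓ x v hv => ?_⟩
  set a : Fin 4 → ℝ := fun j => ℓ (EuclideanSpace.single j 1) with ha
  have hab : ∀ j, |4 * a j| < ε j := by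
    intro j
    have h1 : |a j| ≤ ‖ℓ‖ := abs_apply_single_le ℓ j
    rw [abs_mul, abs_of_pos (by norm_num : (0 : ℝ) < 4)]
    linarith [hε₀le j]
  -- the Levi form of each `f + 4 a_j ψ_j` is positive
  have hj : ∀ j, 0 < -(mextDeriv (dComplex J f) x ![v, J x v]) +
      4 * (a j * -(mextDeriv (dComplex J (ψ j)) x ![v, J x v])) := by
    intro j
    have h := hpos j (4 * a j) (hab j) x v hv
    rw [levi_add_const_mul hJ hf (hψ j)] at h
    linarith [mul_assoc 4 (a j) (-(mextDeriv (dComplex J (ψ j)) x ![v, J x v]))]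
  -- the Levi form of `f + κ.pert ℓ = f + ∑ a_j ψ_j`
  have hsum : ContMDiff (𝓡∂ 4) 𝓘(ℝ, ℝ) ∞ (fun y => ∑ j, a j * ψ j y) :=
    ContMDiff.sum fun j _ => contMDiff_const.mul (hψ j)
  have hpert : κ.pert ℓ = fun y => ∑ j, a j * ψ j y := pert_eq_sum κ ℓ
  rw [hpert, levi_add hJ hf hsum, levi_sum hJ Finset.univ hψ a x, Fin.sum_univ_four]
  have h0 := hj 0
  have h1 := hj 1
  have h2 := hj 2
  have h3 := hj 3
  linarith

end Threshold

end Literature.Geometry.Symplectic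

end
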